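import Summits.FinalStateConjecture.FinalStateConjecture.Theorems.ZeroEnergyKerrOrBombSymplecticDualOfTheBombDefs2
import Summits.FinalStateConjecture.FinalStateConjecture.Theorems.ZeroEnergyKerrOrBombStationaryLimitReductionTimeEquivariantMaps
import Literature.Geometry.Lorentzian.BackgroundChartCalculus
import Literature.Geometry.Lorentzian.SpacetimeLocalConvergenceRestrict
import Literature.Geometry.Lorentzian.KerrScriLeafGap
import Literature.Geometry.Lorentzian.KerrLeafEnergyComparison
import HarnessLib

/-!
# Route ZeroEnergyKerrOrBomb · crux `FinalStateFromKerrOrBomb` (stmt-FinalStateConjecture-17839), line `SketchIdeator1` —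
# stub `stub_recutJunctionCoreB` (m5, boost-honest junction core), brick B3: LATE FLAT COORDINATES ARE FAR FROM EVERY HOLE

Helper file (`--supports stmt-FinalStateConjecture-17839`; registered helpers `recutJunction_farFlat`,
`recutJunction_farFlat_deep`, `recutJunction_eventually_certified_of_deep`, `recutJunction_restLate_of_deep`) of the lead's
wave-7 stub worker W19 (2026-08-17); brick B3 of the boost-general junction plan `work/stubs/W17-boost-audit.md` §7.2
(Step F, F1) / §7.3.

THE STATEMENT (`recutJunction_farFlat`). Hypotheses, verbatim from the binder list of `SigM.stub_recutJunctionCoreB`: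
clause (i) (`C^k` convergence of the hole charts on the growing certified truncated rest slabs `{timeᵢ = τ, radiusᵢ ≤ Rᵢ τ}`),
the Kerr identifications `IsKerrChartedWith` (+ `cᵢ = 1`, the landed brick p144329), and the certified agreement clause
(a_R) (hole chart = flat chart at doubly-late certified common coordinates); the flat `C^k` convergence is a structure
field. Conclusion: for every hole `i` and every bound `R*` there is a lab time `T` such that every common coordinate
`y ∈ U₀ ∩ Dᵢ` which is lab-late (`T ≤ y⁰`), rest-late (`τ₀ < timeᵢ y`, qualitatively), a d.o.c.-part coordinate of hole `i`,
and certified ON A NEIGHBOURHOOD (`∀ᶠ y' in 𝓝 y, radiusᵢ y' ≤ Rᵢ (timeᵢ y')`) has `R* ≤ radiusᵢ y`: the late flat domain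
does not reach down into the near zone `{radiusᵢ < R*}` of any hole. `recutJunction_farFlat_deep` is the form consumed by
Step F (extra binders: `Rᵢ` monotone, (e′), (ℓ)): lab-late DEEP d.o.c.-part flat coordinates
`radiusᵢ y ≤ Rᵢ (timeᵢ y − s₀) − W` (`s₀ > 0`, `W ≥ W₀(i)`) are far from hole `i` — deep coordinates are certified on a
neighbourhood (`recutJunction_eventually_certified_of_deep`: the adapted radius is within a constant of the continuous
rest-frame spatial norm, the rest time is continuous) and rest-late (`recutJunction_restLate_of_deep`, from (e′) + (ℓ)).
The rest time of a lab-late coordinate of bounded rest radius is large in absolute value for EVERY motion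
(`y⁰ − cᵢ⁰ ≤ ‖Λᵢ‖ (|timeᵢ y| + ‖(Pᵢ⁻¹y)_{sp}‖)`, `sub_le_opNorm_mul_of_poincareInv`), and positive by rest-lateness.

THE MECHANISM (W17 §7.3, row B3). At such a `y` the two charts agree on a neighbourhood ((a_R) is applicable near `y`:
lateness is open, certification is assumed open), so the pulled-back metric COMPONENTS at `y` coincide
(`metricInCoords` only sees the germ of the parametrisation): `G := (Ψ₀^* g)(y) = (ψᵢ^* g)(y)`. By flat convergence
`‖G − η‖ < ε` (slab `{x⁰ = y⁰}`), by clause (i) `‖G − g_{Aᵢ} ∘ Pᵢ⁻¹‖ < ε` (certified truncated slab through `y`), hence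
`‖g_{Aᵢ}(Pᵢ⁻¹ ·)(Λᵢ⁻¹ ·, Λᵢ⁻¹ ·) − η‖ < 2ε` as bilinear forms on `E4`. Test on `v = Λᵢ e₀`: `η(v, v) = η(e₀, e₀) = −1`
(Lorentz invariance), while with `Pᵢ⁻¹ y = Θᵢ x`, `x ∈ Kerr.exterior` (d.o.c. part) and `dΘᵢ e₀ = cᵢ e₀ = e₀`
(`T`-equivariance, `cᵢ = 1`), the isometry clause gives `g_{Aᵢ}(Θᵢ x)(e₀, e₀) = g_{M,a}(x)(e₀, e₀) = −1 + 2H(x)`. So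
`2H(x) ≤ 2ε ‖Λᵢ e₀‖²`. But if `radiusᵢ y < R*` then `r(x) < R_b := |R*| + |L| + |r₊| + 1` (radial distortion bound of
`Θᵢ` far out, trivial near the horizon) and `H(x) ≥ M r/(r² + a²) ≥ M²/(R_b² + M²) =: h > 0` (`Kerr.div_le_scalarH`,
`r > r₊ ≥ M > |a|`): contradiction once `ε (‖Λᵢe₀‖² + 1) ≤ h`. No isochrony, no orthochrony, no time function is used.
Elementary; nothing restated; no named fact.
References: Kerr–Schild 1965, §2 (`g = η + 2Hℓ⊗ℓ`); Visser arXiv:0706.0622, (33); Dafermos–Luk arXiv:1710.01722,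
Conjecture 1 (b)–(c); O'Neill 1983, Ch. 3, Def. 3.9 (pullbacks see germs), Ch. 9, p. 233 (Lorentz group).
-/

set_option linter.dupNamespace false
set_option maxSynthPendingDepth 3

noncomputable section

open scoped Manifold ContDiff Topology ENNReal
open Set Filter Function

namespace Summit.FinalStateConjecture.FinalStateConjecture.Theorems.SymplecticDualOfTheBomb

open Literature.Geometry.Lorentzian Summit.FinalStateConjecture.FinalStateConjecture.Theorems.OneLockedExplosion

/-! ## §1 Pointwise preliminaries -/

section Prelim

variable (𝓢 : Spacetime.{0} 4) (B : ModelBackground)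

/-- Private copy of `norm_deviation_lt_of_truncDeviationCk_lt` (`…JunctionTimeFunction.lean`, unbuilt today):
`C⁰`-closeness on a truncated slab is pointwise closeness. [folklore] -/
private theorem norm_deviation_lt_of_truncDeviationCk_lt_w7 (ψ : B.domain → 𝓢.carrier) {k : ℕ} {R τ ε : ℝ}
    (hε : 0 < ε) (h : 𝓢.truncDeviationCk B ψ k R τ < ENNReal.ofReal ε) {x : B.domain}
    (hx : x ∈ B.truncTimeSlab R τ) : ‖𝓢.deviation B ψ x‖ < ε := by
  have h2 := enorm_iteratedFDeriv_le_supCkENorm (Nat.zero_le k) (mem_image_of_mem Subtype.val hx)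
    (𝓢.deviationExtend B ψ)
  rw [← ofReal_norm, norm_iteratedFDeriv_zero, 𝓢.deviationExtend_coe] at h2
  exact (ENNReal.ofReal_lt_ofReal_iff hε).1 (h2.trans_lt h)

/-- The same on a full slab: `deviationCk < ε` is pointwise `C⁰`-closeness `< ε` on `{t = τ}`. [folklore] -/
private theorem norm_deviation_lt_of_deviationCk_lt_w7 (ψ : B.domain → 𝓢.carrier) {k : ℕ} {τ ε : ℝ}
    (hε : 0 < ε) (h : 𝓢.deviationCk B ψ k τ < ENNReal.ofReal ε) {x : B.domain}
    (hx : x ∈ B.timeSlab τ) : ‖𝓢.deviation B ψ x‖ < ε := by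
  have h2 := enorm_iteratedFDeriv_le_supCkENorm (Nat.zero_le k) (mem_image_of_mem Subtype.val hx)
    (𝓢.deviationExtend B ψ)
  rw [← ofReal_norm, norm_iteratedFDeriv_zero, 𝓢.deviationExtend_coe] at h2
  exact (ENNReal.ofReal_lt_ofReal_iff hε).1 (h2.trans_lt h)

/-- **Charts with the same germ have the same deviation up to the backgrounds.** Two smooth chart maps `ψ`, `Ψ₀` on open
domains of `E4`, read against backgrounds `B₁`, `B₀`, which agree on a neighbourhood of a common point `y`, have equal
pulled-back metric components at `y` (`metricInCoords` of the parametrisations `ψ ∘ (chartAt E4 ·).symm` only sees germs),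
so `(Ψ₀^* g − g₀⁰)(y) − (ψ^* g − g₀¹)(y) = g₀¹(y) − g₀⁰(y)`. [cite: ONeill1983, Ch. 3, Def. 3.9] -/
theorem deviation_sub_deviation_of_eventuallyEq (B₁ B₀ : ModelBackground) (ψ : B₁.domain → 𝓢.carrier)
    (Ψ₀ : B₀.domain → 𝓢.carrier) (hψ : ContMDiff 𝓘(ℝ, E4) (𝓡 4) ∞ ψ) (hΨ : ContMDiff 𝓘(ℝ, E4) (𝓡 4) ∞ Ψ₀)
    {y : E4} (hy₁ : y ∈ (B₁.domain : Set E4)) (hy₀ : y ∈ (B₀.domain : Set E4))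
    (h : ∀ᶠ y' in 𝓝 y, ∀ (h₁ : y' ∈ (B₁.domain : Set E4)) (h₀ : y' ∈ (B₀.domain : Set E4)),
      ψ ⟨y', h₁⟩ = Ψ₀ ⟨y', h₀⟩) :
    𝓢.deviation B₀ Ψ₀ ⟨y, hy₀⟩ - 𝓢.deviation B₁ ψ ⟨y, hy₁⟩ = B₁.bilin y - B₀.bilin y := by
  have he : (ψ ∘ (chartAt E4 (⟨y, hy₁⟩ : B₁.domain)).symm) =ᶠ[𝓝 y]
      (Ψ₀ ∘ (chartAt E4 (⟨y, hy₀⟩ : B₀.domain)).symm) := by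
    filter_upwards [h, B₁.domain.2.mem_nhds hy₁, B₀.domain.2.mem_nhds hy₀] with y' hy' h₁ h₀
    rw [show (ψ ∘ (chartAt E4 (⟨y, hy₁⟩ : B₁.domain)).symm) y' = ψ ⟨y', h₁⟩ from
        congrFun (Spacetime.comp_chartAt_symm_comp_subtypeVal ψ ⟨y, hy₁⟩) ⟨y', h₁⟩,
      show (Ψ₀ ∘ (chartAt E4 (⟨y, hy₀⟩ : B₀.domain)).symm) y' = Ψ₀ ⟨y', h₀⟩ from
        congrFun (Spacetime.comp_chartAt_symm_comp_subtypeVal Ψ₀ ⟨y, hy₀⟩) ⟨y', h₀⟩]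
    exact hy' h₁ h₀
  rw [← 𝓢.metricInCoords_comp_chartAt_symm_sub_eq_deviation B₁ ψ ⟨y, hy₁⟩ hy₁
      ((hψ _).mdifferentiableAt (by simp)),
    ← 𝓢.metricInCoords_comp_chartAt_symm_sub_eq_deviation B₀ Ψ₀ ⟨y, hy₀⟩ hy₀
      ((hΨ _).mdifferentiableAt (by simp)), 𝓢.metricInCoords_congr_of_eventuallyEq he]
  abel

end Prelim

/-! ## §2 The Kerr–Schild gap: `H ≥ M²/(R_b² + M²) > 0` on `{r₊ < r ≤ R_b}` -/

/-- **Uniform lower bound of the Kerr–Schild scalar in a bounded exterior zone**: for sub-extremal `(M, a)` and an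
exterior point with `r(x) ≤ R_b`, `M²/(R_b² + M²) ≤ H(x)` (`H ≥ M r/(r² + a²)`, `r > r₊ ≥ M > |a|`). [cite: arXiv07060622, (33)] -/
theorem kerr_sq_div_le_scalarH {M a : ℝ} (hsub : Kerr.IsSubextremal M a) {x : E4}
    (hx : x ∈ (Kerr.exterior M a : Set E4)) {Rb : ℝ} (hxR : Kerr.radius a x ≤ Rb) :
    M ^ 2 / (Rb ^ 2 + M ^ 2) ≤ Kerr.scalarH M a x := by
  have hM : 0 < M := hsub.pos
  have hr : 0 < Kerr.radius a x := Kerr.radius_pos_of_mem_region hx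
  have hrp : Kerr.rPlus M a < Kerr.radius a x := (le_max_left _ _).trans_lt (Kerr.mem_exterior.1 hx)
  have hMr : M ≤ Kerr.radius a x := by
    have : M ≤ Kerr.rPlus M a := le_add_of_nonneg_right (Real.sqrt_nonneg _)
    linarith
  have ha2 : a ^ 2 < M ^ 2 := sq_lt_sq' (abs_lt.1 hsub).1 (abs_lt.1 hsub).2
  refine le_trans ?_ (Kerr.div_le_scalarH hM.le hr (a := a))
  rw [div_le_div_iff₀ (by positivity) (by positivity)]
  have h1 : M ^ 2 * Kerr.radius a x ^ 2 ≤ M ^ 2 * Rb ^ 2 :=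
    mul_le_mul_of_nonneg_left (pow_le_pow_left₀ hr.le hxR 2) (sq_nonneg M)
  have h2 : M ^ 2 * a ^ 2 ≤ M ^ 2 * M ^ 2 := mul_le_mul_of_nonneg_left ha2.le (sq_nonneg M)
  have h3 : M ^ 2 * (Rb ^ 2 + M ^ 2) ≤ M * Kerr.radius a x * (Rb ^ 2 + M ^ 2) := by
    have : M ^ 2 ≤ M * Kerr.radius a x := by nlinarith
    exact mul_le_mul_of_nonneg_right this (by positivity)
  nlinarith

/-! ## §3 One hole: closeness of the moved adapted form to `η` at a d.o.c.-part coordinate bounds `2H` -/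

section Hole

variable {𝓑 : StationaryAFBlackHole.{0}} (A : 𝓑.AdaptedChart) (Λ : lorentzGroup) (c₀ : E4) {M a c r₀ : ℝ}
  {Θ : E4 → E4}

/-- **The gap inequality.** Under `IsKerrChartedWith 𝓑 A M a c r₀ Θ` with `c = 1`: if the moved adapted form
`g_A(P⁻¹ y)(Λ⁻¹ ·, Λ⁻¹ ·)` at a coordinate `y` with `P⁻¹ y = Θ x`, `x ∈ Kerr.exterior`, is `ε`-close to `η` in operator
norm, then `2H(x) ≤ ε ‖Λ e₀‖²`: test both forms on `v = Λ e₀`, `η(v, v) = −1` (Lorentz invariance) and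
`g_A(Θ x)(e₀, e₀) = g_A(Θ x)(dΘ e₀, dΘ e₀) = g_{M,a}(x)(e₀, e₀) = −1 + 2H(x)` (`dΘ e₀ = c e₀ = e₀`, isometry clause).
[cite: KerrSchild1965, §2] -/
theorem two_mul_scalarH_le_of_norm_sub_le (hW : IsKerrChartedWith 𝓑 A M a c r₀ Θ) (hc1 : c = 1) {y x : E4}
    (hx : x ∈ (Kerr.exterior M a : Set E4)) (hxy : Θ x = poincareInv Λ c₀ y) {U : TopologicalSpace.Opens E4}
    {ε : ℝ} (h : ‖(A.background.boost Λ c₀).bilin y - (Minkowski.backgroundOn U).bilin y‖ ≤ ε) :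
    2 * Kerr.scalarH M a x ≤ ε * ‖(Λ : E4 ≃L[ℝ] E4) (E4.basisVector 0)‖ ^ 2 := by
  obtain ⟨-, -, -, hr₀, hΘs, -, -, hΘe, hiso, -, -⟩ := hW
  set v : E4 := (Λ : E4 ≃L[ℝ] E4) (E4.basisVector 0) with hv
  have hxr : x ∈ (Kerr.region a r₀ : Set E4) :=
    Kerr.mem_region.2 ((max_le_max hr₀.le le_rfl).trans_lt (Kerr.mem_exterior.1 hx))
  have hdΘ : fderiv ℝ Θ x (E4.basisVector 0) = E4.basisVector 0 := by
    rw [fderiv_apply_basisVector_zero_of_contDiffOn (Kerr.region a r₀).isOpen (by simp) hΘs hΘe hxr, hc1, one_smul]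
  have hA : A.bilin (Θ x) (E4.basisVector 0) (E4.basisVector 0) = -1 + 2 * Kerr.scalarH M a x := by
    have h' := hiso x hx (E4.basisVector 0) (E4.basisVector 0)
    rwa [hdΘ, Kerr.bilin_basisVector_zero_basisVector_zero] at h'
  have hsymm : (Λ : E4 ≃L[ℝ] E4).symm v = E4.basisVector 0 := (Λ : E4 ≃L[ℝ] E4).symm_apply_apply _
  have hB₁ : (A.background.boost Λ c₀).bilin y v v = -1 + 2 * Kerr.scalarH M a x := by
    rw [ModelBackground.boost_bilin_apply, StationaryAFBlackHole.AdaptedChart.background_bilin, hsymm, ← hxy, hA]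
  have hB₀ : (Minkowski.backgroundOn U).bilin y v v = -1 := by
    show Minkowski.bilin v v = -1
    rw [hv, mem_lorentzGroup_iff.1 Λ.2, Minkowski.bilin_basisVector_zero]
  have h1 : |((A.background.boost Λ c₀).bilin y - (Minkowski.backgroundOn U).bilin y) v v| ≤ ε * ‖v‖ ^ 2 := by
    rw [← Real.norm_eq_abs]
    refine (ContinuousLinearMap.le_opNorm₂ _ v v).trans ?_
    rw [pow_two, ← mul_assoc]
    exact mul_le_mul_of_nonneg_right (mul_le_mul_of_nonneg_right h (norm_nonneg v)) (norm_nonneg v)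
  rw [sub_apply, sub_apply, hB₁, hB₀] at h1
  have h2 := (abs_le.1 h1).2
  linarith

end Hole

/-! ## §4 The decomposition: late flat coordinates are far from every hole -/

section Decomposition

variable {𝓢 : Spacetime.{0} 4} {O : Set 𝓢.carrier} {k : ℕ} (d : StationaryFinalStateDecomposition 𝓢 O k)
  {M a c r₀ : Fin d.N → ℝ} {Θ : Fin d.N → E4 → E4}

/-- Private copy of `exists_kerr_of_mem_docPart` (`…RecutCoreCOFlatSteer.lean`, unbuilt today): a d.o.c.-part coordinate
of hole `i` has Kerr–Schild coordinates, `Pᵢ⁻¹ y = Θᵢ x`, `x ∈ Kerr.exterior` (anchor clause). [folklore] -/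
private theorem exists_kerr_of_mem_docPart_w7 {i : Fin d.N}
    (hW : IsKerrChartedWith (d.hole i) (d.adapted i) (M i) (a i) (c i) (r₀ i) (Θ i))
    {y : (d.background i).domain} (hy : y ∈ docPart d i) :
    ∃ x ∈ (Kerr.exterior (M i) (a i) : Set E4), Θ i x = poincareInv (d.motion i).1 (d.motion i).2 y.1 := by
  have h : poincareInv (d.motion i).1 (d.motion i).2 y.1 ∈ Θ i '' (Kerr.exterior (M i) (a i) : Set E4) := by
    rw [hW.2.2.2.2.2.2.2.2.2.1]; exact hy
  obtain ⟨x, hx, hxy⟩ := h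
  exact ⟨x, hx, hxy⟩

end Decomposition

/-! ### Kinematics: lab-late coordinates of bounded rest radius have large rest time (no orthochrony needed) -/

/-- `‖u‖² = (u⁰)² + ‖u_{space}‖²`. [folklore] -/
private theorem norm_sq_eq_time_sq_add_w7 (u : E4) : ‖u‖ ^ 2 = (u 0) ^ 2 + E4.spatialNorm u ^ 2 := by
  -- private copy of `norm_sq_eq_time_sq_add` (…KerrAsymptoticRigidityMass, unbuilt today)
  rw [EuclideanSpace.real_norm_sq_eq, E4.spatialNorm_sq, Fin.sum_univ_four]
  ring

/-- `‖u‖ ≤ |u⁰| + ‖u_{space}‖`. [folklore] -/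
private theorem norm_le_abs_add_spatialNorm_w7 (u : E4) : ‖u‖ ≤ |u 0| + E4.spatialNorm u := by
  have h := norm_sq_eq_time_sq_add_w7 u
  have h1 : 0 ≤ |u 0| := abs_nonneg _
  have h2 : 0 ≤ E4.spatialNorm u := E4.spatialNorm_nonneg u
  refine le_of_pow_le_pow_left₀ two_ne_zero (by positivity) ?_
  rw [h]
  nlinarith [sq_abs (u 0), mul_nonneg h1 h2]

/-- **Lab time is controlled by rest time and rest radius**: for the motion `(Λ, c)` and a lab coordinate `y` with rest
coordinates `x' = Λ⁻¹(y − c)`, `y⁰ − c⁰ = (Λ x')⁰ ≤ ‖Λ‖ (|x'⁰| + ‖x'_{space}‖)` (crude operator-norm form of the Lorentz time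
sandwich; valid for EVERY `Λ`, orthochronous or not). [cite: ONeill1983, Ch. 9, p. 236] -/
theorem sub_le_opNorm_mul_of_poincareInv (Λ : lorentzGroup) (c y : E4) :
    y 0 - c 0 ≤ ‖((Λ : E4 ≃L[ℝ] E4) : E4 →L[ℝ] E4)‖ * (|poincareInv Λ c y 0| + E4.spatialNorm (poincareInv Λ c y)) := by
  have e1 : y 0 - c 0 = ((Λ : E4 ≃L[ℝ] E4) (poincareInv Λ c y)) 0 := by
    rw [poincareInv, ContinuousLinearEquiv.apply_symm_apply]; rfl
  calc y 0 - c 0 = ((Λ : E4 ≃L[ℝ] E4) (poincareInv Λ c y)) 0 := e1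
    _ ≤ |((Λ : E4 ≃L[ℝ] E4) (poincareInv Λ c y)) 0| := le_abs_self _
    _ ≤ ‖(Λ : E4 ≃L[ℝ] E4) (poincareInv Λ c y)‖ := by
      simpa using PiLp.norm_apply_le ((Λ : E4 ≃L[ℝ] E4) (poincareInv Λ c y)) 0
    _ ≤ ‖((Λ : E4 ≃L[ℝ] E4) : E4 →L[ℝ] E4)‖ * ‖poincareInv Λ c y‖ :=
      ((Λ : E4 ≃L[ℝ] E4) : E4 →L[ℝ] E4).le_opNorm (poincareInv Λ c y)
    _ ≤ ‖((Λ : E4 ≃L[ℝ] E4) : E4 →L[ℝ] E4)‖ * (|poincareInv Λ c y 0| + E4.spatialNorm (poincareInv Λ c y)) :=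
      mul_le_mul_of_nonneg_left (norm_le_abs_add_spatialNorm_w7 _) (norm_nonneg _)

/-- **Registered helper `recutJunction_farFlat` (brick B3 of stub `stub_recutJunctionCoreB`): late flat coordinates are far
from every hole.** For a stationary decomposition `d` with clause (i) on the growing certified truncated slabs, Kerr
identifications `Θᵢ` (`IsKerrChartedWith`, `cᵢ = 1`) and the certified agreement clause (a_R): for every hole `i` and bound
`R*` there is `T` such that every coordinate `y` of the moved adapted domain of hole `i` which is a flat coordinate, lab-late
(`T ≤ y⁰`), rest-late (`τ₀ < timeᵢ y`), certified on a neighbourhood of `y`, and a d.o.c.-part coordinate, has adapted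
radius `radiusᵢ y ≥ R*` (flat `C⁰`-closeness and hole `C⁰`-closeness at the same germ versus the gap `2H ≥ 2M²/(R_b² + M²)`;
the rest time of such a `y` with `radiusᵢ y < R*` is large because `y⁰ − cᵢ⁰ ≤ ‖Λᵢ‖ (|timeᵢ y| + radiusᵢ y + C)`).
[cite: DafermosLuk2017, Conjecture 1 (b)–(c)] -/
theorem recutJunction_farFlat : ∀ {𝓢 : Spacetime.{0} 4} {O : Set 𝓢.carrier} {k : ℕ} (d : StationaryFinalStateDecomposition 𝓢 O k) (M a c r₀ : Fin d.N → ℝ) (Θ : Fin d.N → E4 → E4) (R : Fin d.N → ℝ → ℝ), (∀ i, Tendsto (fun τ ↦ 𝓢.truncDeviationCk (d.background i) (d.toOver.chart i) k (R i τ) τ) atTop (𝓝 0)) → (∀ i, IsKerrChartedWith (d.hole i) (d.adapted i) (M i) (a i) (c i) (r₀ i) (Θ i)) → (∀ i, c i = 1) → (∀ (i : Fin d.N) (y : (d.background i).domain) (h : (y : E4) ∈ d.toOver.flatDomain), d.toOver.τ₀ < (d.background i).time y.1 → d.toOver.τ₀ < (y : E4) 0 → (d.background i).radius y.1 ≤ R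 i ((d.background i).time y.1) → d.toOver.chart i y = d.toOver.flatChart ⟨y, h⟩) → ∀ (i : Fin d.N) (Rstar : ℝ), ∃ T : ℝ, ∀ (y : (d.background i).domain) (h : (y : E4) ∈ d.toOver.flatDomain), T ≤ (y : E4) 0 → d.toOver.τ₀ < (d.background i).time y.1 → (∀ᶠ y' in 𝓝 (y : E4), (d.background i).radius y' ≤ R i ((d.background i).time y')) → y ∈ docPart d i → Rstar ≤ (d.background i).radius y.1 := by
  intro 𝓢 O k d M a c r₀ Θ R hRi hW hc1 hRa i Rstar
  obtain ⟨hsub, -, -, -, -, -, -, -, -, -, L, hL⟩ := hW i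
  obtain ⟨C, hC⟩ := (d.adapted i).exists_abs_radius_sub_spatialNorm_le
  have hM : 0 < M i := hsub.pos
  -- the radius bound `Rb` in the contradiction branch and the gap `hgap ≤ H`
  set Rb : ℝ := |Rstar| + |L| + |Kerr.rPlus (M i) (a i)| + 1 with hRb
  set hgap : ℝ := M i ^ 2 / (Rb ^ 2 + M i ^ 2) with hhgap
  have hgap_pos : 0 < hgap := by positivity
  -- the pinching level `ε` with `2 ε ‖Λᵢ e₀‖² < 2 hgap`
  set v : E4 := ((d.motion i).1 : E4 ≃L[ℝ] E4) (E4.basisVector 0) with hv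
  set ε : ℝ := hgap / (‖v‖ ^ 2 + 1) with hε
  have hεpos : 0 < ε := by positivity
  have hεv : ε * ‖v‖ ^ 2 < hgap := by
    have h1 : ε * (‖v‖ ^ 2 + 1) = hgap := by rw [hε]; field_simp
    have h2 : ε * ‖v‖ ^ 2 = hgap - ε := by rw [← h1]; ring
    linarith
  obtain ⟨T₁, hT₁⟩ := eventually_atTop.1 ((hRi i).eventually (gt_mem_nhds (ENNReal.ofReal_pos.2 hεpos)))
  obtain ⟨T₀, hT₀⟩ := eventually_atTop.1
    (d.toOver.tendsto_deviationCk_flat.eventually (gt_mem_nhds (ENNReal.ofReal_pos.2 hεpos)))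
  -- the lab-time threshold: flat pinching after `T₀`, lab-lateness, and hole pinching forced through the kinematic bound
  set K : ℝ := ‖(((d.motion i).1 : E4 ≃L[ℝ] E4) : E4 →L[ℝ] E4)‖ with hK
  have hK0 : 0 ≤ K := norm_nonneg _
  set T₁' : ℝ := max (max T₁ 0) |d.toOver.τ₀| with hT₁'
  have hT₁'0 : 0 ≤ T₁' := (le_max_right _ _).trans (le_max_left _ _)
  refine ⟨max (max T₀ (d.toOver.τ₀ + 1)) ((d.motion i).2 0 + K * (T₁' + (|Rstar| + |C|)) + 1),
    fun y h hTy hτ₀t hcert hdoc ↦ ?_⟩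
  obtain ⟨y, hyD⟩ := y
  have hT₀y : T₀ ≤ y 0 := ((le_max_left _ _).trans (le_max_left _ _)).trans hTy
  have hτ₀l : d.toOver.τ₀ < y 0 := (lt_add_one _).trans_le (((le_max_right _ _).trans (le_max_left _ _)).trans hTy)
  have hTK : (d.motion i).2 0 + K * (T₁' + (|Rstar| + |C|)) + 1 ≤ y 0 := (le_max_right _ _).trans hTy
  replace hτ₀t : d.toOver.τ₀ < (d.background i).time y := hτ₀t
  by_contra hlt
  push Not at hlt
  -- rest-lateness of `y`: `|timeᵢ y| > T₁'`, and the negative sign is excluded by `τ₀ < timeᵢ y`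
  have hT₁y : T₁ ≤ (d.background i).time y := by
    have hs : E4.spatialNorm (poincareInv (d.motion i).1 (d.motion i).2 y) ≤ |Rstar| + |C| := by
      have h1 := (abs_le.1 (hC (poincareInv (d.motion i).1 (d.motion i).2 y))).1
      have e : (d.adapted i).radius (poincareInv (d.motion i).1 (d.motion i).2 y) = (d.background i).radius y := rfl
      linarith [le_abs_self Rstar, le_abs_self C]
    have hkin := sub_le_opNorm_mul_of_poincareInv (d.motion i).1 (d.motion i).2 y
    have et : poincareInv (d.motion i).1 (d.motion i).2 y 0 = (d.background i).time y := rfl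
    rw [← hK, et] at hkin
    have habs : T₁' < |(d.background i).time y| := by
      by_contra hle
      push Not at hle
      have h2 : K * (|(d.background i).time y| + E4.spatialNorm (poincareInv (d.motion i).1 (d.motion i).2 y)) ≤
          K * (T₁' + (|Rstar| + |C|)) := mul_le_mul_of_nonneg_left (add_le_add hle hs) hK0
      linarith
    rcases lt_abs.1 habs with h3 | h3
    · exact ((le_max_left _ _).trans (le_max_left _ _)).trans h3.le
    · exfalso
      have h4 : |d.toOver.τ₀| ≤ T₁' := le_max_right _ _
      linarith [neg_abs_le d.toOver.τ₀]
  -- Kerr–Schild coordinates of `y` and the bound `r(x) ≤ Rb`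
  obtain ⟨x, hx, hxy⟩ := exists_kerr_of_mem_docPart_w7 d (hW i) hdoc
  have hrad : (d.adapted i).radius (Θ i x) = (d.background i).radius y := by rw [hxy]; rfl
  have hrx : Kerr.radius (a i) x ≤ Rb := by
    by_cases hfar : Kerr.rPlus (M i) (a i) + 1 ≤ Kerr.radius (a i) x
    · have h1 := (abs_le.1 (hL x hx hfar).2.1).1
      rw [hrad] at h1
      have : (d.background i).radius y ≤ |Rstar| := hlt.le.trans (le_abs_self _)
      linarith [le_abs_self L, abs_nonneg (Kerr.rPlus (M i) (a i))]
    · push Not at hfar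
      linarith [le_abs_self (Kerr.rPlus (M i) (a i)), abs_nonneg Rstar, abs_nonneg L]
  have hH : hgap ≤ Kerr.scalarH (M i) (a i) x := kerr_sq_div_le_scalarH hsub hx hrx
  -- `C⁰`-closeness of both charts at `y`
  have hdev₁ : ‖𝓢.deviation (d.background i) (d.toOver.chart i) ⟨y, hyD⟩‖ < ε :=
    norm_deviation_lt_of_truncDeviationCk_lt_w7 𝓢 (d.background i) (d.toOver.chart i) hεpos (hT₁ _ hT₁y)
      ⟨rfl, hcert.self_of_nhds⟩
  have hdev₀ : ‖𝓢.deviation (Minkowski.backgroundOn d.toOver.flatDomain) d.toOver.flatChart ⟨y, h⟩‖ < ε :=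
    norm_deviation_lt_of_deviationCk_lt_w7 𝓢 (Minkowski.backgroundOn d.toOver.flatDomain) d.toOver.flatChart hεpos
      (hT₀ _ hT₀y) rfl
  -- (a_R) on a neighbourhood of `y`: the two charts have the same germ at `y`
  have hct : Continuous fun y' : E4 ↦ (d.background i).time y' :=
    (PiLp.continuous_apply 2 _ 0).comp (continuous_poincareInv (d.motion i).1 (d.motion i).2)
  have hcl : Continuous fun y' : E4 ↦ y' 0 := PiLp.continuous_apply 2 _ 0
  have hgerm : ∀ᶠ y' in 𝓝 y, ∀ (h₁ : y' ∈ ((d.background i).domain : Set E4))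
      (h₀ : y' ∈ ((Minkowski.backgroundOn d.toOver.flatDomain).domain : Set E4)),
      d.toOver.chart i ⟨y', h₁⟩ = d.toOver.flatChart ⟨y', h₀⟩ := by
    filter_upwards [hcert, (hct.tendsto y).eventually (lt_mem_nhds hτ₀t), (hcl.tendsto y).eventually (lt_mem_nhds hτ₀l)]
      with y' h1 h2 h3 h₁ h₀
    exact hRa i ⟨y', h₁⟩ h₀ h2 h3 h1
  have hsub' := deviation_sub_deviation_of_eventuallyEq 𝓢 (d.background i) (Minkowski.backgroundOn d.toOver.flatDomain)
    (d.toOver.chart i) d.toOver.flatChart (d.toOver.isLateChart i).contMDiff d.toOver.isLateChart_flat.contMDiff hyD h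
    hgerm
  have hnorm : ‖(d.background i).bilin y - (Minkowski.backgroundOn d.toOver.flatDomain).bilin y‖ ≤ ε + ε := by
    rw [← hsub']
    exact (norm_sub_le _ _).trans (add_le_add hdev₀.le hdev₁.le)
  have key := two_mul_scalarH_le_of_norm_sub_le (d.adapted i) (d.motion i).1 (d.motion i).2 (hW i) (hc1 i) hx hxy hnorm
  rw [← hv] at key
  nlinarith [hH, hεv, key]

/-- **Registered helper `recutJunction_eventually_certified_of_deep`: deep coordinates are certified on a neighbourhood.**
For monotone radii `Rᵢ` there is a margin `W₀` (depending on the hole only: twice the radius/spatial-norm comparison constant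
of the adapted chart plus one) such that a coordinate `y` with `radiusᵢ y ≤ Rᵢ (timeᵢ y − s₀) − W`, `s₀ > 0`, `W ≥ W₀`, has a
neighbourhood of certified coordinates `radiusᵢ ≤ Rᵢ ∘ timeᵢ` (the rest time `(Λᵢ⁻¹(· − cᵢ))⁰` and the rest spatial norm are
continuous, `|radius_A − ‖·‖_{sp}| ≤ C`). [folklore] -/
theorem recutJunction_eventually_certified_of_deep : ∀ {𝓢 : Spacetime.{0} 4} {O : Set 𝓢.carrier} {k : ℕ} (d : StationaryFinalStateDecomposition 𝓢 O k) (R : Fin d.N → ℝ → ℝ), (∀ i, Monotone (R i)) → ∀ i : Fin d.N, ∃ W₀ : ℝ, ∀ (s₀ W : ℝ) (y : E4), 0 < s₀ → W₀ ≤ W → (d.background i).radius y ≤ R i ((d.background i).time y - s₀) - W → ∀ᶠ y' in 𝓝 y, (d.background i).radius y' ≤ R i ((d.background i).time y') := by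
  intro 𝓢 O k d R hRm i
  obtain ⟨C, hC⟩ := (d.adapted i).exists_abs_radius_sub_spatialNorm_le
  refine ⟨2 * C + 1, fun s₀ W y hs₀ hW hdeep ↦ ?_⟩
  have hct : Continuous fun y' : E4 ↦ (d.background i).time y' :=
    (PiLp.continuous_apply 2 _ 0).comp (continuous_poincareInv (d.motion i).1 (d.motion i).2)
  have hcn : Continuous fun y' : E4 ↦ E4.spatialNorm (poincareInv (d.motion i).1 (d.motion i).2 y') :=
    (continuous_norm.comp E4.spatial.continuous).comp (continuous_poincareInv (d.motion i).1 (d.motion i).2)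
  have ht : ∀ᶠ y' in 𝓝 y, (d.background i).time y - s₀ < (d.background i).time y' :=
    (hct.tendsto y).eventually (lt_mem_nhds (by linarith))
  have hn : ∀ᶠ y' in 𝓝 y, E4.spatialNorm (poincareInv (d.motion i).1 (d.motion i).2 y') <
      E4.spatialNorm (poincareInv (d.motion i).1 (d.motion i).2 y) + 1 :=
    (hcn.tendsto y).eventually (gt_mem_nhds (by linarith))
  filter_upwards [ht, hn] with y' h1 h2
  have e1 : (d.background i).radius y' = (d.adapted i).radius (poincareInv (d.motion i).1 (d.motion i).2 y') := rfl
  have e0 : (d.background i).radius y = (d.adapted i).radius (poincareInv (d.motion i).1 (d.motion i).2 y) := rfl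
  have h3 := (abs_le.1 (hC (poincareInv (d.motion i).1 (d.motion i).2 y'))).2
  have h4 := (abs_le.1 (hC (poincareInv (d.motion i).1 (d.motion i).2 y))).1
  have h5 : R i ((d.background i).time y - s₀) ≤ R i ((d.background i).time y') := hRm i h1.le
  rw [e1]
  rw [e0] at hdeep
  linarith

/-- **Registered helper `recutJunction_restLate_of_deep`: lab-late deep coordinates are rest-late.** From monotone `Rᵢ`,
clause (e′) (excision radii `→ ∞`) and clause (ℓ) (eventually in lab time, coordinates within the excision scale of hole `i`
are rest-late): for every hole `i` there is a lab time `T` after which every DEEP coordinate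
(`radiusᵢ y ≤ Rᵢ (timeᵢ y − s₀) − W`, `s₀, W ≥ 0`) is rest-late, `τ₀ < timeᵢ y` (were `timeᵢ y ≤ τ₀`, monotonicity would give
`radiusᵢ y ≤ Rᵢ τ₀ ≤ excisionᵢ (y⁰) + 1`, and (ℓ) would make `y` rest-late). [folklore] -/
theorem recutJunction_restLate_of_deep : ∀ {𝓢 : Spacetime.{0} 4} {O : Set 𝓢.carrier} {k : ℕ} (d : StationaryFinalStateDecomposition 𝓢 O k) (R : Fin d.N → ℝ → ℝ), (∀ i, Monotone (R i)) → (∀ i : Fin d.N, Tendsto (d.toOver.excision i) atTop atTop) → (∀ i : Fin d.N, ∃ T : ℝ, ∀ y : (d.background i).domain, T < (y : E4) 0 → (d.background i).radius y.1 ≤ d.toOver.excision i ((y : E4) 0) + 1 → d.toOver.τ₀ < (d.background i).time y.1) → ∀ i : Fin d.N, ∃ T : ℝ, ∀ (s₀ W : ℝ) (y : (d.background i).domain), 0 ≤ s₀ → 0 ≤ W → T ≤ (y : E4) 0 → (d.background i).radius y.1 ≤ R i ((d.background i).time y.1 - s₀) - W → d.toOver.τ₀ < (d.background i).time y.1 :=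 by
  intro 𝓢 O k d R hRm he' hℓ i
  obtain ⟨Tℓ, hTℓ⟩ := hℓ i
  obtain ⟨Te, hTe⟩ := eventually_atTop.1 ((he' i).eventually_ge_atTop (R i d.toOver.τ₀))
  refine ⟨max (Tℓ + 1) Te, fun s₀ W y hs₀ hW hTy hdeep ↦ ?_⟩
  by_contra hle
  push Not at hle
  refine absurd (hTℓ y ?_ ?_) (not_lt.2 hle)
  · linarith [le_max_left (Tℓ + 1) Te]
  · have h1 : R i ((d.background i).time y.1 - s₀) ≤ R i d.toOver.τ₀ := hRm i (by linarith)
    have h2 := hTe _ ((le_max_right _ _).trans hTy)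
    linarith

/-- **Registered helper `recutJunction_farFlat_deep` (brick B3, the form consumed by Step F of the junction plan): late DEEP
flat coordinates are far from every hole.** With clause (i), monotone `Rᵢ`, `IsKerrChartedWith` + `cᵢ = 1`, (a_R), (e′) and
(ℓ): for every hole `i` there is a margin `W₀`, and for every bound `R*` a lab time `T`, such that every flat coordinate `y`
of the moved adapted domain of hole `i` with `T ≤ y⁰` which is DEEP (`radiusᵢ y ≤ Rᵢ (timeᵢ y − s₀) − W`, `s₀ > 0`, `W ≥ W₀`)
and in the d.o.c. part has `R* ≤ radiusᵢ y` (deep ⇒ rest-late and certified on a neighbourhood; then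
`recutJunction_farFlat`). [cite: DafermosLuk2017, Conjecture 1 (b)–(c)] -/
theorem recutJunction_farFlat_deep : ∀ {𝓢 : Spacetime.{0} 4} {O : Set 𝓢.carrier} {k : ℕ} (d : StationaryFinalStateDecomposition 𝓢 O k) (M a c r₀ : Fin d.N → ℝ) (Θ : Fin d.N → E4 → E4) (R : Fin d.N → ℝ → ℝ), (∀ i, Tendsto (fun τ ↦ 𝓢.truncDeviationCk (d.background i) (d.toOver.chart i) k (R i τ) τ) atTop (𝓝 0)) → (∀ i, Monotone (R i)) → (∀ i, IsKerrChartedWith (d.hole i) (d.adapted i) (M i) (a i) (c i) (r₀ i) (Θ i)) → (∀ i, c i = 1) → (∀ (i : Fin d.N) (y : (d.background i).domain) (h : (y : E4) ∈ d.toOver.flatDomain), d.toOver.τ₀ < (d.background i).time y.1 → d.toOver.τ₀ < (y : E4) 0 → (d.background i).radius y.1 ≤ R i ((d.background i).time y.1) → d.toOver.chart i y = d.toOver.flatChart ⟨y, h⟩) → (∀ i : Fin d.N, Tendsto (d.toOver.excision i) atTop atTop) → (∀ i : Fin d.N, ∃ T : ℝ, ∀ y : (d.background i).domain, T < (y : E4)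 0 → (d.background i).radius y.1 ≤ d.toOver.excision i ((y : E4) 0) + 1 → d.toOver.τ₀ < (d.background i).time y.1) → ∀ i : Fin d.N, ∃ W₀ : ℝ, ∀ Rstar : ℝ, ∃ T : ℝ, ∀ (s₀ W : ℝ) (y : (d.background i).domain) (h : (y : E4) ∈ d.toOver.flatDomain), 0 < s₀ → W₀ ≤ W → T ≤ (y : E4) 0 → (d.background i).radius y.1 ≤ R i ((d.background i).time y.1 - s₀) - W → y ∈ docPart d i → Rstar ≤ (d.background i).radius y.1 := by
  intro 𝓢 O k d M a c r₀ Θ R hRi hRm hW hc1 hRa he' hℓ i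
  obtain ⟨W₀, hW₀⟩ := recutJunction_eventually_certified_of_deep d R hRm i
  obtain ⟨Tr, hTr⟩ := recutJunction_restLate_of_deep d R hRm he' hℓ i
  refine ⟨max W₀ 0, fun Rstar ↦ ?_⟩
  obtain ⟨T, hT⟩ := recutJunction_farFlat d M a c r₀ Θ R hRi hW hc1 hRa i Rstar
  refine ⟨max T Tr, fun s₀ W y h hs₀ hWW hTy hdeep hdoc ↦ hT y h ((le_max_left _ _).trans hTy) ?_
    (hW₀ s₀ W y.1 hs₀ ((le_max_left _ _).trans hWW) hdeep) hdoc⟩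
  exact hTr s₀ W y hs₀.le ((le_max_right _ _).trans hWW) ((le_max_right _ _).trans hTy) hdeep

end Summit.FinalStateConjecture.FinalStateConjecture.Theorems.SymplecticDualOfTheBomb

end
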